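import Summits.RiemannHypothesis.RiemannHypothesis.Theses.WeilGroundState
import Summits.RiemannHypothesis.RiemannHypothesis.Theorems.WeilGroundStateGroundStatesConvergeToXiEvenWitnessParity
import Literature.NumberTheory.LFunctions.WeilGroundState
import Literature.NumberTheory.LFunctions.WeilMellinBounds
import Literature.NumberTheory.LFunctions.WeilMellinInversion
import Literature.NumberTheory.LFunctions.RiemannXi
import Literature.NumberTheory.LFunctions.RiemannXiHadamardProduct
import HarnessLib

/-!
# RiemannHypothesis / WeilGroundState — crux witnesses may be taken EVEN
(parity normal form of `GroundStatesConvergeToXi`)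

Route `RiemannHypothesis/WeilGroundState`, crux item stmt-RiemannHypothesis-1527
(`GroundStatesConvergeToXi`), line `Sketch`, continuation lead c4 (helper file, `--supports`).

With the parity lemmas of `…EvenWitnessParity` (reflection and normalised even part of a ground
state are ground states) and `ξ(1 - s) = ξ(s)` (`riemannXi_one_sub`):

* `exists_even_cruxWitness` — given a crux-shaped witness `(a_k, u_k, c_k)` (`a_k → ∞`, ground
  states `u_k`, `c_k · weilMellin u_k → ξ` locally uniformly on the open strip), there is one of
  the same shape with EVEN ground states: `c_k û_k(1 - s) → ξ(1 - s) = ξ(s)` locally uniformly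
  as well (`s ↦ 1 - s` preserves the strip), `û_k(1 - ·) = (u_k(-·))^` (`weilMellin_comp_neg`),
  so `c_k (u_kᵉ)^ → ξ`; at `s = 1/2`, `ξ(1/2) ≠ 0` (`riemannXi_one_half_ne_zero`)
  forces `u_kᵉ ≠ 0` and `c_k ≠ 0` eventually; the normalised even parts `u_kᵉ/‖u_kᵉ‖₂` are
  ground states (`isWeilGroundState_evenPart`) and `c'_k = c_k‖u_kᵉ‖₂` recombines the limit.
* `eventually_ne_zero_and_weilMellin_half_ne_zero`, `eventually_not_odd_of_cruxWitness` — a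
  crux-shaped witness has `c_k ≠ 0` and `∫ u_k = û_k(1/2) ≠ 0` eventually; its ground states are
  eventually not odd.
* `groundStatesConvergeToXi_iff_even` — **parity normal form of the crux (RH-free)**:
  `GroundStatesConvergeToXi` holds iff it holds with even ground states `u_k(-t) = u_k(t)`.

* `weilEvenGroundEnergy_eq_of_even_groundState`, `eventually_weilEvenGroundEnergy_eq_of_cruxWitness`,
  `frequently_weilEvenGroundEnergy_le_odd_of_groundStatesConvergeToXi` — **the even sector must
  be at the bottom along the witness windows**: an even ground state at `a` gives `ε_ev(a) = ε(a)`
  (`= min(ε_ev, ε_od)`, `WeilGroundEnergyParitySplit`); along a crux-shaped witness this holds at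
  `a_k` for all large `k`; so the crux implies `ε_ev(a) ≤ ε_od(a)` frequently as `a → ∞` —
  equivalently **if `ε_od(a) < ε_ev(a)` for all large `a`, the crux is FALSE** (a parity
  obstruction stated on the tree's `weilOddGroundEnergy` / `weilEvenGroundEnergy`).

Reading for the route: of the Connes–van Suijlekom hypothesis "simple AND even bottom"
(`WeilWindowSimpleEven`, crux #2 `GroundStateSimpleEven`), the parity of the WITNESS of crux #3
is never an obstruction — a crux witness can always be chosen inside the even sector; only the
window property (simplicity of the bottom / the spectral gap) carries content.  In particular,
at a witness window whose bottom eigenspace is one-dimensional, the crux forces that bottom to be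
EVEN (an odd bottom has `û(1/2) = ∫u = 0 ≠ ξ(1/2)/c`).

Mathlib + proved tree material only; no named fact; no definitions; standard axioms.
-/

set_option linter.dupNamespace false

noncomputable section

open MeasureTheory Complex Filter Set
open scoped Real Topology

namespace Summit.RiemannHypothesis.RiemannHypothesis.Theorems.GroundStatesConvergeToXi

open Literature.NumberTheory.LFunctions

/-! ### Even crux witnesses -/

/-- An a.e.-null `L²` function has identically vanishing transform. [folklore] -/
theorem weilMellin_eq_zero_of_integral_norm_sq_eq_zero {f : ℝ → ℂ} (hf : MemLp f 2)
    (h0 : ∫ t, ‖f t‖ ^ 2 = 0) (s : ℂ) : weilMellin f s = 0 := by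
  have hi := integrable_norm_sq_of_memLp hf
  have hae : (fun t ↦ ‖f t‖ ^ 2) =ᵐ[volume] 0 :=
    (integral_eq_zero_iff_of_nonneg (fun t ↦ sq_nonneg ‖f t‖) hi).1 h0
  have hf0 : ∀ᵐ t ∂volume, f t = 0 := hae.mono fun t ht ↦ by simpa using ht
  have hcongr : (fun t : ℝ ↦ f t * cexp ((s - 1 / 2) * t)) =ᵐ[volume] fun _ ↦ 0 :=
    hf0.mono fun t ht ↦ by simp [ht]
  unfold weilMellin
  rw [integral_congr_ae hcongr]
  simp

/-- Transform of the even part of a ground state: `(uᵉ)^(s) = (û(s) + û(1 - s))/2`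
(`û(1 - ·) = (u(-·))^`, `weilMellin_comp_neg`). [folklore] -/
theorem weilMellin_evenPart {a : ℝ} {u : ℝ → ℂ} (hu : IsWeilGroundState a u) (s : ℂ) :
    weilMellin (fun t ↦ (u t + u (-t)) / 2) s = (weilMellin u s + weilMellin u (1 - s)) / 2 := by
  rw [← weilMellin_comp_neg u s]
  unfold weilMellin
  rw [← integral_add (hu.integrable_mul_cexp _)
    ((isWeilGroundState_comp_neg hu).integrable_mul_cexp _), ← integral_div]
  congr 1 with t
  ring

/-- **A crux-shaped witness is eventually non-degenerate at `s = 1/2`**: if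
`c_k · weilMellin u_k → ξ` locally uniformly on the open strip then eventually `c_k ≠ 0` and
`û_k(1/2) = ∫ u_k ≠ 0` (pointwise convergence at `1/2` to `ξ(1/2) ≠ 0`,
`riemannXi_one_half_ne_zero`). [folklore] -/
theorem eventually_ne_zero_and_weilMellin_half_ne_zero {u : ℕ → ℝ → ℂ} {c : ℕ → ℂ}
    (hlim : TendstoLocallyUniformlyOn (fun k s ↦ c k * weilMellin (u k) s) riemannXi atTop
      {s : ℂ | 0 < s.re ∧ s.re < 1}) :
    ∀ᶠ k in atTop, c k ≠ 0 ∧ weilMellin (u k) (1 / 2) ≠ 0 := by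
  have hhalf : (1 / 2 : ℂ) ∈ {s : ℂ | 0 < s.re ∧ s.re < 1} := by
    simp only [mem_setOf_eq]
    norm_num
  filter_upwards [(hlim.tendsto_at hhalf).eventually_ne riemannXi_one_half_ne_zero] with k hk
  exact ⟨left_ne_zero_of_mul hk, right_ne_zero_of_mul hk⟩

/-- An odd integrable function has `û(1/2) = ∫ u = 0`. [folklore] -/
theorem weilMellin_half_eq_zero_of_odd {u : ℝ → ℂ} (hodd : ∀ t, u (-t) = -u t) :
    weilMellin u (1 / 2) = 0 := by
  have h1 : weilMellin u (1 / 2) = ∫ t, u t := by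
    unfold weilMellin
    congr 1 with t
    simp
  have h2 : ∫ t, u t = -∫ t, u t := by
    calc ∫ t, u t = ∫ t, u (-t) := (integral_neg_eq_self u volume).symm
      _ = ∫ t, -u t := by simp_rw [hodd]
      _ = -∫ t, u t := integral_neg u
  rw [h1]
  linear_combination h2 / 2

/-- **The ground states of a crux-shaped witness are eventually NOT odd** (an odd `u_k` has
`û_k(1/2) = 0`, while `c_k û_k(1/2) → ξ(1/2) ≠ 0`).  So at a witness window whose bottom
eigenspace is spanned by a single function of definite parity, that parity is EVEN. [folklore] -/
theorem eventually_not_odd_of_cruxWitness {u : ℕ → ℝ → ℂ} {c : ℕ → ℂ}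
    (hlim : TendstoLocallyUniformlyOn (fun k s ↦ c k * weilMellin (u k) s) riemannXi atTop
      {s : ℂ | 0 < s.re ∧ s.re < 1}) :
    ∀ᶠ k in atTop, ¬ ∀ t, u k (-t) = -u k t := by
  filter_upwards [eventually_ne_zero_and_weilMellin_half_ne_zero hlim] with k hk hodd
  exact hk.2 (weilMellin_half_eq_zero_of_odd hodd)

/-- **Crux witnesses may be taken even (RH-free).**  Let `a_k → ∞`, `u_k` ground states at the
windows `a_k` and `c_k` scalars with `c_k · weilMellin u_k → ξ` locally uniformly on the open
critical strip (the shape of `GroundStatesConvergeToXi`).  Then there is a witness of the same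
shape whose ground states are EVEN, `v_k(-t) = v_k(t)`: a tail of the sequence of normalised even
parts `v_k = u_kᵉ/‖u_kᵉ‖₂` with `c'_k = c_k ‖u_kᵉ‖₂`.  Indeed `c_k û_k(1 - s) → ξ(1 - s) = ξ(s)`
locally uniformly (`s ↦ 1 - s` preserves the strip), `û_k(1 - ·) = (u_k(-·))^`
(`weilMellin_comp_neg`), so `c_k (u_kᵉ)^ → ξ`; at `s = 1/2`, `ξ(1/2) ≠ 0` forces `u_kᵉ ≠ 0` and
`c_k ≠ 0` eventually; and `u_kᵉ/‖u_kᵉ‖₂` is a ground state (`isWeilGroundState_evenPart`). [folklore] -/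
theorem exists_even_cruxWitness {a : ℕ → ℝ} {u : ℕ → ℝ → ℂ} {c : ℕ → ℂ}
    (ha : Tendsto a atTop atTop) (hu : ∀ k, IsWeilGroundState (a k) (u k))
    (hlim : TendstoLocallyUniformlyOn (fun k s ↦ c k * weilMellin (u k) s) riemannXi atTop
      {s : ℂ | 0 < s.re ∧ s.re < 1}) :
    ∃ a' : ℕ → ℝ, ∃ v : ℕ → ℝ → ℂ, ∃ c' : ℕ → ℂ, Tendsto a' atTop atTop ∧ (∀ k, c' k ≠ 0) ∧
      (∀ k, IsWeilGroundState (a' k) (v k)) ∧ (∀ k t, v k (-t) = v k t) ∧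
      TendstoLocallyUniformlyOn (fun k s ↦ c' k * weilMellin (v k) s) riemannXi atTop
        {s : ℂ | 0 < s.re ∧ s.re < 1} := by
  have hS : IsOpen {s : ℂ | 0 < s.re ∧ s.re < 1} :=
    (isOpen_lt continuous_const Complex.continuous_re).inter
      (isOpen_lt Complex.continuous_re continuous_const)
  -- the reflected witness converges as well
  have hrefl : TendstoLocallyUniformlyOn (fun k s ↦ c k * weilMellin (fun t ↦ u k (-t)) s)
      riemannXi atTop {s : ℂ | 0 < s.re ∧ s.re < 1} := by
    have hmaps : MapsTo (fun s : ℂ ↦ 1 - s) {s : ℂ | 0 < s.re ∧ s.re < 1}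
        {s : ℂ | 0 < s.re ∧ s.re < 1} := fun s hs ↦ by
      simp only [mem_setOf_eq, sub_re, one_re] at hs ⊢
      constructor <;> linarith [hs.1, hs.2]
    have h := hlim.comp (fun s : ℂ ↦ 1 - s) hmaps (continuous_const.sub continuous_id).continuousOn
    have hξ : riemannXi ∘ (fun s : ℂ ↦ 1 - s) = riemannXi := funext fun s ↦ riemannXi_one_sub s
    rw [hξ] at h
    refine h.congr fun k s _ ↦ ?_
    simp only [Function.comp_apply, weilMellin_comp_neg]
  -- hence so do the even parts
  have hMe : ∀ k s, weilMellin (fun t ↦ (u k t + u k (-t)) / 2) s =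
      (weilMellin (u k) s + weilMellin (fun t ↦ u k (-t)) s) / 2 := fun k s ↦ by
    rw [weilMellin_evenPart (hu k), weilMellin_comp_neg]
  have heven : TendstoLocallyUniformlyOn
      (fun k s ↦ c k * weilMellin (fun t ↦ (u k t + u k (-t)) / 2) s) riemannXi atTop
      {s : ℂ | 0 < s.re ∧ s.re < 1} := by
    rw [tendstoLocallyUniformlyOn_iff_forall_isCompact hS] at hlim hrefl ⊢
    intro K hKS hK
    have h1 := Metric.tendstoUniformlyOn_iff.1 (hlim K hKS hK)
    have h2 := Metric.tendstoUniformlyOn_iff.1 (hrefl K hKS hK)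
    rw [Metric.tendstoUniformlyOn_iff]
    intro ε hε
    filter_upwards [h1 ε hε, h2 ε hε] with k hk1 hk2 s hs
    have e1 : riemannXi s - c k * weilMellin (fun t ↦ (u k t + u k (-t)) / 2) s =
        ((riemannXi s - c k * weilMellin (u k) s) +
          (riemannXi s - c k * weilMellin (fun t ↦ u k (-t)) s)) / 2 := by
      rw [hMe]
      ring
    rw [dist_eq_norm, e1, norm_div, Complex.norm_two]
    have h3 := norm_add_le (riemannXi s - c k * weilMellin (u k) s)
      (riemannXi s - c k * weilMellin (fun t ↦ u k (-t)) s)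
    have h4 := hk1 s hs
    have h5 := hk2 s hs
    rw [dist_eq_norm] at h4 h5
    linarith
  -- at `s = 1/2` the limit `ξ(1/2) ≠ 0`: eventually the even parts (and the `c_k`) are non-zero
  have hhalf : (1 / 2 : ℂ) ∈ {s : ℂ | 0 < s.re ∧ s.re < 1} := by
    simp only [mem_setOf_eq]
    norm_num
  have hev : ∀ᶠ k in atTop, c k * weilMellin (fun t ↦ (u k t + u k (-t)) / 2) (1 / 2) ≠ 0 :=
    (heven.tendsto_at hhalf).eventually_ne riemannXi_one_half_ne_zero
  obtain ⟨K₀, hK₀⟩ := eventually_atTop.1 hev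
  have hNpos : ∀ k, 0 < ∫ t, ‖(u (k + K₀) t + u (k + K₀) (-t)) / 2‖ ^ 2 := by
    intro k
    have hne := hK₀ (k + K₀) (Nat.le_add_left _ _)
    have hnn : 0 ≤ ∫ t, ‖(u (k + K₀) t + u (k + K₀) (-t)) / 2‖ ^ 2 :=
      integral_nonneg fun _ ↦ by positivity
    rcases hnn.eq_or_lt with h0 | hpos
    · exfalso
      apply hne
      rw [weilMellin_eq_zero_of_integral_norm_sq_eq_zero (memLp_evenPart (hu _).1) h0.symm,
        mul_zero]
    · exact hpos
  have hcne : ∀ k, c (k + K₀) ≠ 0 := fun k h ↦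
    hK₀ (k + K₀) (Nat.le_add_left _ _) (by rw [h, zero_mul])
  -- the even witness: a tail of the normalised even parts
  refine ⟨fun k ↦ a (k + K₀),
    fun k t ↦ (((Real.sqrt (∫ s, ‖(u (k + K₀) s + u (k + K₀) (-s)) / 2‖ ^ 2))⁻¹ : ℝ) : ℂ) *
      ((u (k + K₀) t + u (k + K₀) (-t)) / 2),
    fun k ↦ c (k + K₀) * (Real.sqrt (∫ s, ‖(u (k + K₀) s + u (k + K₀) (-s)) / 2‖ ^ 2) : ℂ),
    ha.comp (tendsto_add_atTop_nat K₀), fun k ↦ ?_,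
    fun k ↦ isWeilGroundState_evenPart (hu _) (hNpos k), fun k t ↦ ?_, ?_⟩
  · exact mul_ne_zero (hcne k) (Complex.ofReal_ne_zero.2 (Real.sqrt_ne_zero'.2 (hNpos k)))
  · simp only [neg_neg]
    ring
  · have hshift : TendstoLocallyUniformlyOn
        (fun k s ↦ c (k + K₀) * weilMellin (fun t ↦ (u (k + K₀) t + u (k + K₀) (-t)) / 2) s)
        riemannXi atTop {s : ℂ | 0 < s.re ∧ s.re < 1} := by
      rw [tendstoLocallyUniformlyOn_iff_forall_isCompact hS] at heven ⊢
      intro K hKS hK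
      have h := Metric.tendstoUniformlyOn_iff.1 (heven K hKS hK)
      rw [Metric.tendstoUniformlyOn_iff]
      intro ε hε
      exact (tendsto_add_atTop_nat K₀).eventually (h ε hε)
    refine hshift.congr fun k s _ ↦ ?_
    have hR : (Real.sqrt (∫ s, ‖(u (k + K₀) s + u (k + K₀) (-s)) / 2‖ ^ 2) : ℂ) ≠ 0 :=
      Complex.ofReal_ne_zero.2 (Real.sqrt_ne_zero'.2 (hNpos k))
    rw [weilMellin_const_mul, Complex.ofReal_inv, ← mul_assoc, mul_assoc (c (k + K₀)),
      mul_inv_cancel₀ hR, mul_one]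

/-- **Parity normal form of the crux (RH-free).**  `GroundStatesConvergeToXi` holds if and only
if it holds with EVEN ground states: windows `a_k → ∞`, even ground states `u_k`
(`IsWeilGroundState (a k) (u k)`, `u_k(-t) = u_k(t)`) and `c_k ≠ 0` with
`c_k · weilMellin u_k → riemannXi` locally uniformly on the open critical strip. [folklore] -/
theorem groundStatesConvergeToXi_iff_even :
    Summit.RiemannHypothesis.RiemannHypothesis.Theses.WeilGroundState.GroundStatesConvergeToXi ↔
      ∃ a : ℕ → ℝ, ∃ u : ℕ → ℝ → ℂ, ∃ c : ℕ → ℂ, Tendsto a atTop atTop ∧ (∀ k, c k ≠ 0) ∧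
        (∀ k, IsWeilGroundState (a k) (u k)) ∧ (∀ k t, u k (-t) = u k t) ∧
        TendstoLocallyUniformlyOn (fun k s ↦ c k * weilMellin (u k) s) riemannXi atTop
          {s : ℂ | 0 < s.re ∧ s.re < 1} := by
  constructor
  · rintro ⟨a, u, c, ha, hk, hlim⟩
    exact exists_even_cruxWitness ha (fun k ↦ ⟨(hk k).2.2.1, (hk k).2.2.2⟩) hlim
  · rintro ⟨a, u, c, ha, hc, hu, -, hlim⟩
    exact ⟨a, u, c, ha, fun k ↦ ⟨(hu k).pos, hc k, (hu k).1, (hu k).2⟩, hlim⟩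

/-! ### The even sector attains the bottom at the witness windows -/

/-- `∫‖fᵒ‖² ≤ ∫‖f‖²` for `f ∈ L²`. [folklore] -/
theorem integral_norm_sq_oddPart_le_of_memLp {f : ℝ → ℂ} (hf : MemLp f 2) :
    ∫ t, ‖(f t - f (-t)) / 2‖ ^ 2 ≤ ∫ t, ‖f t‖ ^ 2 := by
  have h := integral_norm_sq_evenPart_add_oddPart_of_memLp hf
  have h0 : 0 ≤ ∫ t, ‖(f t + f (-t)) / 2‖ ^ 2 := integral_nonneg fun _ ↦ by positivity
  linarith

/-- **An even ground state puts the even sector at the bottom**: if `u` is a ground state at the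
window `a` with `u(-t) = u(t)`, then `ε_ev(a) = ε(a)` (`weilEvenGroundEnergy`, Bombieri's `μ⁺`,
Suzuki's `λ_a⁺`; always `ε = min(ε_ev, ε_od)`, `weilGroundEnergy_eq_min_even_odd`).  Proof: for
the minimising sequence `gₙ → u`, the odd parts are `oₙ = (gₙ - u)ᵒ`, so `‖oₙ‖² ≤ ‖gₙ - u‖² → 0`,
while `ε_ev‖eₙ‖² ≤ Re Q(eₙ) = Re Q(gₙ) - Re Q(oₙ) ≤ Re Q(gₙ) - ε‖oₙ‖²` with `‖eₙ‖² = 1 - ‖oₙ‖²`;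
let `n → ∞`. [folklore] -/
theorem weilEvenGroundEnergy_eq_of_even_groundState {a : ℝ} {u : ℝ → ℂ}
    (hu : IsWeilGroundState a u) (heven : ∀ t, u (-t) = u t) :
    weilEvenGroundEnergy a = weilGroundEnergy a := by
  refine le_antisymm ?_ (weilGroundEnergy_le_weilEvenGroundEnergy a)
  obtain ⟨hmem, g, hg, hQ, hL⟩ := hu
  have hgm : ∀ n, MemLp (g n) 2 := fun n ↦
    (hg n).1.1.continuous.memLp_of_hasCompactSupport (hg n).1.2
  -- the odd parts tend to `0` in `L²`
  set No : ℕ → ℝ := fun n ↦ ∫ t, ‖(g n t - g n (-t)) / 2‖ ^ 2 with hNodef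
  have hNo_le : ∀ n, No n ≤ ∫ t, ‖g n t - u t‖ ^ 2 := fun n ↦ by
    have h1 := integral_norm_sq_oddPart_le_of_memLp ((hgm n).sub hmem)
    have e1 : (fun t ↦ ‖(g n t - g n (-t)) / 2‖ ^ 2) =
        fun t ↦ ‖((g n - u) t - (g n - u) (-t)) / 2‖ ^ 2 := by
      funext t
      simp only [Pi.sub_apply, heven t]
      congr 2
      ring
    show (∫ t, ‖(g n t - g n (-t)) / 2‖ ^ 2) ≤ _
    rw [e1]
    simpa only [Pi.sub_apply] using h1
  have hNo : Tendsto No atTop (𝓝 0) :=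
    squeeze_zero (fun n ↦ integral_nonneg fun _ ↦ by positivity) hNo_le hL
  -- parity splitting of norms and energies
  have hsplit : ∀ n, (∫ t, ‖(g n t + g n (-t)) / 2‖ ^ 2) + No n = 1 := fun n ↦ by
    have := integral_norm_sq_evenPart_add_oddPart (hg n).1
    rw [(hg n).2.2] at this
    exact this
  have hQsplit : ∀ n, (weilQuadratic (g n)).re =
      (weilQuadratic (fun t ↦ (g n t + g n (-t)) / 2)).re +
        (weilQuadratic (fun t ↦ (g n t - g n (-t)) / 2)).re := fun n ↦ by
    rw [weilQuadratic_eq_evenPart_add_oddPart (hg n).1, Complex.add_re]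
  have h1 : ∀ n, weilEvenGroundEnergy a * (1 - No n) ≤
      (weilQuadratic (g n)).re - weilGroundEnergy a * No n := by
    intro n
    have hE := weilEvenGroundEnergy_mul_le_re (hg n).1.evenPart
      (tsupport_evenPart_subset_Icc (hg n).2.1) (fun t ↦ by simp only [neg_neg]; ring)
    have hO := weilGroundEnergy_mul_integral_norm_sq_le (hg n).1.oddPart
      (tsupport_oddPart_subset_Icc (hg n).2.1)
    have hs := hsplit n
    have hq := hQsplit n
    have e1 : (∫ t, ‖(g n t + g n (-t)) / 2‖ ^ 2) = 1 - No n := by linarith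
    rw [e1] at hE
    have hO' : weilGroundEnergy a * No n ≤ (weilQuadratic (fun t ↦ (g n t - g n (-t)) / 2)).re := hO
    linarith
  have hlhs : Tendsto (fun n ↦ weilEvenGroundEnergy a * (1 - No n)) atTop
      (𝓝 (weilEvenGroundEnergy a * (1 - 0))) :=
    tendsto_const_nhds.mul (tendsto_const_nhds.sub hNo)
  have hrhs : Tendsto (fun n ↦ (weilQuadratic (g n)).re - weilGroundEnergy a * No n) atTop
      (𝓝 (weilGroundEnergy a - weilGroundEnergy a * 0)) :=
    hQ.sub (tendsto_const_nhds.mul hNo)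
  have := le_of_tendsto_of_tendsto' hlhs hrhs h1
  simpa using this

/-- **Along a crux-shaped witness the even sector is eventually at the bottom**:
`ε_ev(a_k) = ε(a_k)`, i.e. `ε_ev(a_k) ≤ ε_od(a_k)` (`weilGroundEnergy_eq_min_even_odd`), for all
large `k`.  (Eventually `∫ u_k ≠ 0`, so the even part of `u_k` is non-zero and its normalisation is
an even ground state at `a_k`.) [folklore] -/
theorem eventually_weilEvenGroundEnergy_eq_of_cruxWitness {a : ℕ → ℝ} {u : ℕ → ℝ → ℂ}
    {c : ℕ → ℂ} (hu : ∀ k, IsWeilGroundState (a k) (u k))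
    (hlim : TendstoLocallyUniformlyOn (fun k s ↦ c k * weilMellin (u k) s) riemannXi atTop
      {s : ℂ | 0 < s.re ∧ s.re < 1}) :
    ∀ᶠ k in atTop, weilEvenGroundEnergy (a k) = weilGroundEnergy (a k) := by
  filter_upwards [eventually_ne_zero_and_weilMellin_half_ne_zero hlim] with k hk
  have hN : 0 < ∫ t, ‖(u k t + u k (-t)) / 2‖ ^ 2 := by
    have hnn : 0 ≤ ∫ t, ‖(u k t + u k (-t)) / 2‖ ^ 2 := integral_nonneg fun _ ↦ by positivity
    refine hnn.lt_of_ne fun h0 ↦ hk.2 ?_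
    have h1 := weilMellin_eq_zero_of_integral_norm_sq_eq_zero (memLp_evenPart (hu k).1) h0.symm
      (1 / 2)
    rw [weilMellin_evenPart (hu k), show (1 : ℂ) - 1 / 2 = 1 / 2 by norm_num] at h1
    linear_combination h1
  exact weilEvenGroundEnergy_eq_of_even_groundState (isWeilGroundState_evenPart (hu k) hN)
    fun t ↦ by simp only [neg_neg]; ring

/-- **The crux forces the even sector to the bottom along windows `→ ∞` (RH-free; a parity
obstruction).**  `GroundStatesConvergeToXi` implies `ε_ev(a) ≤ ε_od(a)` frequently as `a → ∞`
(at the witness windows `a_k → ∞`, `ε_ev(a_k) = ε(a_k) ≤ ε_od(a_k)`).  Contrapositive: if the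
odd-sector bottom is eventually STRICTLY below the even one — `weilOddGroundEnergy a <
weilEvenGroundEnergy a` for all large `a` (Bombieri's `μ⁻ < μ⁺`) — the crux is false. [folklore] -/
theorem frequently_weilEvenGroundEnergy_le_odd_of_groundStatesConvergeToXi
    (h : Summit.RiemannHypothesis.RiemannHypothesis.Theses.WeilGroundState.GroundStatesConvergeToXi) :
    ∃ᶠ a in atTop, weilEvenGroundEnergy a ≤ weilOddGroundEnergy a := by
  obtain ⟨a, u, c, ha, hk, hlim⟩ := h
  have hu : ∀ k, IsWeilGroundState (a k) (u k) := fun k ↦ ⟨(hk k).2.2.1, (hk k).2.2.2⟩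
  refine ha.frequently (((eventually_weilEvenGroundEnergy_eq_of_cruxWitness hu hlim).mono
    fun k hk' ↦ ?_).frequently)
  rw [hk']
  exact weilGroundEnergy_le_weilOddGroundEnergy (a k)

end Summit.RiemannHypothesis.RiemannHypothesis.Theorems.GroundStatesConvergeToXi

end
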